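import Literature.MathematicalPhysics.QuantumFieldTheory.ConformalBootstrap3D.PointKernelK34L505Data
import Literature.MathematicalPhysics.QuantumFieldTheory.ConformalBootstrap3D.PointKernelK34L505Segs
import Literature.MathematicalPhysics.QuantumFieldTheory.ConformalBootstrap3D.PointKernelParts

/-!
# K34L505 certificate, kernel part file P26: one-cell head segments 96, 97 in level ranges

The head cells whose kernel evaluation exceeds one `decide` are one-cell segments of `hsegsK34L505`; each is
checked by `PCert.hPartSideOK` (side conditions) and `PCert.hPartOK` per level range `[n_lo, n_lo + count)`
against an integer claim, the claims summing to `≥ 0` (`PointKernel.partsOK`); soundness is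
`PCert.hParts_sound` (`PointKernelParts`).  The part files are mutually independent (each imports only
the data file); the ranges of one cell may span several of them, and the per-cell conclusions
`hparts_i` / `hcell_i` of those cells are assembled in `PointKernelK34L505.lean`.
Estimated kernel time 244 s.
-/

set_option maxRecDepth 100000
set_option maxHeartbeats 0

namespace Literature.MathematicalPhysics.QuantumFieldTheory.ConformalBootstrap3D.PointKernelK34L505

open Literature.MathematicalPhysics.QuantumFieldTheory.ConformalBootstrap3D.PointKernel

/-- levels `[64, 68)` of segment 96: partial lower sum `≥` claim. [folklore] -/
theorem part_96_7 : certK34L505.hPartOK (PCert.segAt hsegsK34L505 96) JHK34L505 64 4 (161046138921656794501612194617219794) = true := by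
  decide +kernel

/-- levels `[68, 71)` of segment 96: partial lower sum `≥` claim. [folklore] -/
theorem part_96_8 : certK34L505.hPartOK (PCert.segAt hsegsK34L505 96) JHK34L505 68 3 (74734097045012836931696081227636905) = true := by
  decide +kernel

/-- levels `[71, 73)` of segment 96: partial lower sum `≥` claim. [folklore] -/
theorem part_96_9 : certK34L505.hPartOK (PCert.segAt hsegsK34L505 96) JHK34L505 71 2 (30980468068641313873662935034312282) = true := by
  decide +kernel

/-- one-cell segment 97 (row 6, cell `[28675/4096, 7169/1024]`, chord, `n_F = 72`,
10 level ranges): side conditions. [folklore] -/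
theorem pside_97 : certK34L505.hPartSideOK (PCert.segAt hsegsK34L505 97) JHK34L505 = true := by
  decide +kernel

/-- its level ranges `(n_lo, count, claim)`. [folklore] -/
def partsK34L505_97 : List (ℕ × ℕ × ℤ) := [(0, 25, -28501947828464557421824358460593277067), (25, 11, 18379988629687444034723934350107183942), (36, 8, 5983602668041237704085395682170000542), (44, 6, 2136574673458733982302438634370584764), (50, 5, 962798424539018234573784330875188202), (55, 5, 544682277668883009328252976029949631), (60, 4, 251554884152588433321628790607065182), (64, 4, 153052983262009067556253066651642203), (68, 3, 66727015591333728902084185148261227), (71, 2, 22966272063309227030586444633401381)]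

/-- the ranges tile `[0, n_F]` and the claims sum to `≥ 0`. [folklore] -/
theorem pcov_97 : PointKernel.partsOK 72 partsK34L505_97 = true := by
  decide +kernel

/-- levels `[0, 25)` of segment 97: partial lower sum `≥` claim. [folklore] -/
theorem part_97_0 : certK34L505.hPartOK (PCert.segAt hsegsK34L505 97) JHK34L505 0 25 (-28501947828464557421824358460593277067) = true := by
  decide +kernel

end Literature.MathematicalPhysics.QuantumFieldTheory.ConformalBootstrap3D.PointKernelK34L505
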